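import Mathlib
import HarnessLib
import Literature.Analysis.FluidPDE.AxisymmetricEuler
import Summits.NavierStokesRegularity.NavierStokesRegularity.Theorems.PoloidalWindowRigidity.Negative.DriftProfile

/-!
# Crux `PoloidalWindowRigidity` (K2, stmt-NavierStokesRegularity-19708, route `PoloidalWindowDoor`) — negative side:
# the parabolic RATES banked from the Oseen-mild identity do not close the residue S2

Negative-side support (refuter seat ns-regularity-refuter1, cell ns-regularity-ideate; D-0081 §C), companion of
`…Negative.DriftProfile` (the drifting discretely self-similar cellular profile `w(t,x) = (−t)^{-1/2} V(A_t x)`,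
`A_t x = (−t)^{-1/2} x + log(−t) e₁`, with its ClassRate-shaped rates and the slice identities (R)(C)(D)(P)(F)).

Here: on every slice the vorticity direction of `w` is constant in no direction, `w` is not vertically rigid, `w·e₂`
is flat in no horizontal direction, `w` is invariant under no translation, not scale-invariant
(`2 w(−4, 0) ≠ w(−1, 0)`: second components `cos(log 4)` vs `1`), invariant under no screw motion (slice `t = −1`,
where `w = V`), and `w` is backward-singular at the apex: on `(−τ, −τ/2) × B(0, √(τ/2))` one has
`|(A_t x)₀|, |(A_t x)₂| ≤ 1`, so `‖w(t,x)‖ ≥ ¼(−t)^{-1/2}`, beating every level for `τ` small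
(`isBackwardSingularPoint_driftProfile`).

`sliceSharpResidue_false_with_classRates_without_mild`: the slice-wise sharpened residue S2
(`stub_sliceSharpNoScrewNonflatLiouville`, skeleton `Cruxes/PoloidalWindowRigidity/Lines/slicesharp.lean` rev 6/7 —
at rev 7 a theorem GIVEN S2′ `stub_residueNoScrewNoGauge`) with the Oseen-mild identity (M) REPLACED by the two
ClassRate bounds, and the all-frames axisymmetry exclusion deleted, is FALSE.

CONSEQUENCE for the K2 line: any proof of S2 / S2′ must use (M) beyond slice regularity AND beyond the scale-sharp
parabolic rates of `…ClassRate`; on the drifting self-similar stratum nothing short of the Oseen–Duhamel structure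
itself is left. (The rev-7 no-source-gauge clause is NOT certified for this witness: `ψ = 2w₂` IS a decaying-slope
stream function here, slope `O(1/(−t))`, with a source that is not a function of `t` alone — informal; that clause is
vacuous only on separated profiles, `…Negative.ResidueStubFalseWithoutMild`.)

WHAT THIS IS NOT: not a claim about Navier–Stokes regularity and not a refutation of K2, S2 or S2′ — a kernel-checked
certificate that (M) cannot be replaced by its banked rate consequences. [folklore]
-/

noncomputable section

namespace Summit.NavierStokesRegularity.NavierStokesRegularity.Theorems.PoloidalWindowRigidity.Negative

open MeasureTheory Set Function Filter Topology Metric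
open scoped RealInnerProductSpace InnerProductSpace ENNReal NNReal
open Literature.Analysis Literature.Analysis.FluidPDE

/-! ## Kinematic and genericity exclusions, slice by slice -/


/-- Vorticity direction constant on no slice: for `b ≠ 0` some `curl w(s)(x) × b ≠ 0` (at the `A_s`-preimages of
`(π/2, 0, π/2)` and `(0, π/2, π/2)` the vorticity is `2(−s)^{-1} e₀`, `−2(−s)^{-1} e₁`). [folklore] -/
theorem vorticityDirection_nonconstant_driftProfile {s : ℝ} (hs : s < 0) (b : EuclideanSpace ℝ (Fin 3))
    (hb : b ≠ 0) : ∃ x : EuclideanSpace ℝ (Fin 3), cross (curl (driftProfile s) x) b ≠ 0 := by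
  by_contra hcon
  simp only [not_exists, ne_eq, not_not] at hcon
  have hamp := (cellAmp_pos hs).ne'
  have key : ∀ y : EuclideanSpace ℝ (Fin 3),
      cross ((cellAmp s ^ 2 * (2 * Real.sin (y 2) * Real.cos (y 1))) •
          (EuclideanSpace.single (0 : Fin 3) (1 : ℝ) : EuclideanSpace ℝ (Fin 3)) +
        (-(cellAmp s ^ 2 * (2 * Real.sin (y 2) * Real.cos (y 0)))) •
          (EuclideanSpace.single (1 : Fin 3) (1 : ℝ) : EuclideanSpace ℝ (Fin 3))) b = 0 := by
    intro y
    have h := hcon ((cellAmp s)⁻¹ • (y - Real.log (-s) • EuclideanSpace.single (1 : Fin 3) (1 : ℝ)))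
    rwa [curl_driftProfile, driftShift_invPoint hs] at h
  have h1 := key ((Real.pi / 2) • EuclideanSpace.single (0 : Fin 3) (1 : ℝ) +
    (Real.pi / 2) • EuclideanSpace.single (2 : Fin 3) (1 : ℝ))
  have h2 := key ((Real.pi / 2) • EuclideanSpace.single (1 : Fin 3) (1 : ℝ) +
    (Real.pi / 2) • EuclideanSpace.single (2 : Fin 3) (1 : ℝ))
  have h1a := congrArg (fun w : EuclideanSpace ℝ (Fin 3) => w 1) h1
  have h1b := congrArg (fun w : EuclideanSpace ℝ (Fin 3) => w 2) h1
  have h2b := congrArg (fun w : EuclideanSpace ℝ (Fin 3) => w 2) h2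
  simp [cross, cross_apply, hamp] at h1a h1b h2b
  apply hb
  ext i
  fin_cases i
  · simpa using h2b
  · simpa using h1b
  · simpa using h1a

/-- Not vertically rigid on any slice: `(Dw(s) e₂)₀ = −(−s)^{-1}` at the `A_s`-preimage of `(0, 0, π/2)`. [folklore] -/
theorem not_vertRigid_driftProfile {s : ℝ} (hs : s < 0) :
    ∃ x : EuclideanSpace ℝ (Fin 3),
      fderiv ℝ (driftProfile s) x (EuclideanSpace.single (2 : Fin 3) (1 : ℝ)) 0 ≠ 0 := by
  refine ⟨(cellAmp s)⁻¹ • ((Real.pi / 2) • EuclideanSpace.single (2 : Fin 3) (1 : ℝ) -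
    Real.log (-s) • EuclideanSpace.single (1 : Fin 3) (1 : ℝ)), ?_⟩
  rw [fderiv_driftProfile_apply, driftShift_invPoint hs, cellDeriv_apply_zero]
  simp [(cellAmp_pos hs).ne']

/-- `w·e₂` is flat in no horizontal direction (transported from the cellular profile). [folklore] -/
theorem flat_in_no_horizontal_direction_driftProfile {s : ℝ} (hs : s < 0) (a : EuclideanSpace ℝ (Fin 3))
    (ha : a ≠ 0) (ha2 : ⟪a, (EuclideanSpace.single (2 : Fin 3) (1 : ℝ) : EuclideanSpace ℝ (Fin 3))⟫_ℝ = 0) :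
    ∃ x : EuclideanSpace ℝ (Fin 3),
      ⟪fderiv ℝ (driftProfile s) x a, (EuclideanSpace.single (2 : Fin 3) (1 : ℝ) : EuclideanSpace ℝ (Fin 3))⟫_ℝ ≠ 0 := by
  obtain ⟨y, hy⟩ := flat_in_no_horizontal_direction_cellProfile hs a ha ha2
  refine ⟨(cellAmp s)⁻¹ • (y - Real.log (-s) • EuclideanSpace.single (1 : Fin 3) (1 : ℝ)), ?_⟩
  rw [EuclideanSpace.inner_single_right, fderiv_driftProfile_apply, driftShift_invPoint hs]
  rw [EuclideanSpace.inner_single_right, fderiv_cellProfile_apply] at hy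
  have hc := (cellAmp_pos hs).ne'
  have hne : cellDeriv y a 2 ≠ 0 := by
    intro h0
    apply hy
    simp [h0]
  simpa [hc] using hne

/-- Invariant under no spatial translation: some translate of the `A_s`-preimage of the origin along `e ≠ 0` changes
the value (`V(0) = (1,1,0)`; a quarter period along a nonzero coordinate of `e` kills a cosine). [folklore] -/
theorem not_translationInvariant_driftProfile {s : ℝ} (hs : s < 0) (e : EuclideanSpace ℝ (Fin 3)) (he : e ≠ 0) :
    ∃ (x : EuclideanSpace ℝ (Fin 3)) (l : ℝ), driftProfile s (x + l • e) ≠ driftProfile s x := by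
  by_contra hcon
  push Not at hcon
  have hc := (cellAmp_pos hs).ne'
  have key : ∀ m : ℝ, cellField (m • e) = cellField 0 := by
    intro m
    have h := hcon ((cellAmp s)⁻¹ • ((0 : EuclideanSpace ℝ (Fin 3)) -
      Real.log (-s) • EuclideanSpace.single (1 : Fin 3) (1 : ℝ))) (m / cellAmp s)
    unfold driftProfile at h
    rw [driftShift_add_smul, driftShift_invPoint hs, zero_add] at h
    have hl : cellAmp s * (m / cellAmp s) = m := by field_simp
    rw [hl] at h
    exact smul_right_injective _ hc h
  by_cases h2 : e 2 = 0
  · by_cases h0 : e 0 = 0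
    · have h1 : e 1 ≠ 0 := by
        intro h1
        apply he
        ext i
        fin_cases i
        · exact h0
        · exact h1
        · exact h2
      have h := congrArg (fun w : EuclideanSpace ℝ (Fin 3) => w 1) (key (Real.pi / 2 / e 1))
      simp [cellField_apply_one, h2, div_mul_cancel₀ _ h1] at h
    · have h := congrArg (fun w : EuclideanSpace ℝ (Fin 3) => w 0) (key (Real.pi / 2 / e 0))
      simp [cellField_apply_zero, h2, div_mul_cancel₀ _ h0] at h
  · have h := congrArg (fun w : EuclideanSpace ℝ (Fin 3) => w 0) (key (Real.pi / 2 / e 2))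
    simp [cellField_apply_zero, div_mul_cancel₀ _ h2] at h

/-- Not scale-invariant: `2 w(−4, 0) ≠ w(−1, 0)` — second components `cos(log 4)` and `1`, and `0 < log 4 < 2π`.
(For `λ = e^{π}` the profile IS `λ`-discretely self-similar.) [folklore] -/
theorem not_scaleInvariant_driftProfile :
    (2 : ℝ) • driftProfile ((2 : ℝ) ^ 2 * (-1)) ((2 : ℝ) • (0 : EuclideanSpace ℝ (Fin 3))) ≠
      driftProfile (-1) 0 := by
  intro h
  have h1 := congrArg (fun w : EuclideanSpace ℝ (Fin 3) => w 1) h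
  have hsqrt : Real.sqrt 4 = 2 := by
    rw [show (4 : ℝ) = 2 ^ 2 by norm_num, Real.sqrt_sq (by norm_num)]
  have h4 : (2 : ℝ) ^ 2 * (-1) = -4 := by norm_num
  rw [h4] at h1
  simp [driftProfile, driftShift, cellAmp, cellField_apply_one, hsqrt] at h1
  have hlog4 : Real.log 4 ≠ 0 := Real.log_ne_zero_of_pos_of_ne_one (by norm_num) (by norm_num)
  have hlt : Real.log 4 < 2 * Real.pi := by
    have := Real.log_le_sub_one_of_pos (show (0 : ℝ) < 4 by norm_num)
    linarith [Real.pi_gt_three]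
  have hgt : -(2 * Real.pi) < Real.log 4 := by
    have := Real.log_pos (show (1 : ℝ) < 4 by norm_num)
    linarith [Real.pi_pos]
  exact hlog4 ((Real.cos_eq_one_iff_of_lt_of_lt hgt hlt).1 h1)

/-- Invariant under no screw motion about a vertical axis (slice `t = −1`, where `w = V`). [folklore] -/
theorem not_screwInvariant_driftProfile (θ : ℝ) (c : EuclideanSpace ℝ (Fin 3)) :
    ∃ y : EuclideanSpace ℝ (Fin 3),
      driftProfile (-1) (c + rotZ θ (y - c) + (Real.pi / 2) • EuclideanSpace.single (2 : Fin 3) (1 : ℝ)) ≠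
        rotZ θ (driftProfile (-1) y) := by
  rw [driftProfile_neg_one]
  exact not_screwInvariant_cellProfile θ c

/-! ## The singularity at the apex -/

/-- **(S) the drifting profile is backward-singular at the apex**: for `(t, x) ∈ (−τ, −τ/2) × B(0, √(τ/2))` the
similarity variable has `|(A_t x)₀|, |(A_t x)₂| ≤ 1`, so `cos (A_t x)₂ cos (A_t x)₀ ≥ ¼` and
`‖w(t, x)‖ ≥ ¼(−t)^{-1/2}`, which exceeds every level for `τ` small — a set of positive measure inside every
parabolic cylinder `Q(0, r)`. [folklore] -/
theorem isBackwardSingularPoint_driftProfile : IsBackwardSingularPoint driftProfile 0 := by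
  intro r hr
  rw [eLpNorm_exponent_top]
  show essSup (fun z => ‖uncurry driftProfile z‖ₑ) _ = ⊤
  apply essSup_eq_top_of_forall_exists_lt
  intro N
  set K : ℝ := (N : ℝ) + 1 with hK
  have hKpos : 0 < K := by positivity
  set C : ℝ := 1 / 4 with hCdef
  have hC : 0 < C := by norm_num
  set τ : ℝ := min (r ^ 2) ((C / K) ^ 2) / 2 with hτ
  have hmin : 0 < min (r ^ 2) ((C / K) ^ 2) := lt_min (by positivity) (by positivity)
  have hτpos : 0 < τ := by positivity
  have hτr : τ < r ^ 2 := by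
    have := min_le_left (r ^ 2) ((C / K) ^ 2)
    rw [hτ]; linarith
  have hτK : τ < (C / K) ^ 2 := by
    have := min_le_right (r ^ 2) ((C / K) ^ 2)
    rw [hτ]; linarith
  set ρ : ℝ := Real.sqrt (τ / 2) with hρ
  have hρpos : 0 < ρ := Real.sqrt_pos.2 (by positivity)
  have hρr : ρ ≤ r := by
    rw [hρ, ← Real.sqrt_sq hr.le]
    exact Real.sqrt_le_sqrt (by linarith)
  refine ⟨Ioo (-τ) (-(τ / 2)) ×ˢ ball 0 ρ, ?_, ?_⟩
  · have hsub : Ioo (-τ) (-(τ / 2)) ×ˢ ball (0 : EuclideanSpace ℝ (Fin 3)) ρ ⊆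
        parabolicCylinder r (0 : ℝ × EuclideanSpace ℝ (Fin 3)) := by
      rintro ⟨t, x⟩ ⟨⟨ht1, ht2⟩, hx⟩
      rw [mem_parabolicCylinder]
      refine ⟨⟨?_, ?_⟩, ?_⟩
      · simp only [Prod.fst_zero]; linarith
      · simp only [Prod.fst_zero]; linarith
      · simp only [Prod.snd_zero]
        exact lt_of_lt_of_le (mem_ball.1 hx) hρr
    rw [Measure.restrict_apply (measurableSet_Ioo.prod measurableSet_ball),
      inter_eq_left.2 hsub, Measure.volume_eq_prod, Measure.prod_prod]
    refine mul_ne_zero ?_ (measure_ball_pos volume (0 : EuclideanSpace ℝ (Fin 3)) hρpos).ne'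
    rw [Real.volume_Ioo, ne_eq, ENNReal.ofReal_eq_zero, not_le]
    linarith
  · rintro ⟨t, x⟩ ⟨⟨ht1, ht2⟩, hx⟩
    simp only [uncurry_apply_pair]
    have hxρ : ‖x‖ < ρ := mem_ball_zero_iff.1 hx
    have hspos : 0 < Real.sqrt (-t) := Real.sqrt_pos.2 (by linarith)
    have hamp : cellAmp t = (Real.sqrt (-t))⁻¹ := rfl
    -- the similarity variable stays in the unit box in the coordinates 0 and 2
    have hρt : ρ ≤ Real.sqrt (-t) := by
      rw [hρ]; exact Real.sqrt_le_sqrt (by linarith)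
    have hcx : cellAmp t * ‖x‖ ≤ 1 := by
      have h1 : cellAmp t * ‖x‖ ≤ cellAmp t * Real.sqrt (-t) :=
        mul_le_mul_of_nonneg_left (hxρ.le.trans hρt) (cellAmp_nonneg t)
      have h2 : cellAmp t * Real.sqrt (-t) = 1 := by rw [hamp]; exact inv_mul_cancel₀ hspos.ne'
      linarith
    have hpi3 : (1 : ℝ) ≤ Real.pi / 3 := by linarith [Real.pi_gt_three]
    have hbox : ∀ i : Fin 3, |cellAmp t * x i| ≤ 1 := by
      intro i
      rw [abs_mul, abs_of_nonneg (cellAmp_nonneg t)]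
      have hxi : |x i| ≤ ‖x‖ := by
        have := PiLp.norm_apply_le x i
        rwa [Real.norm_eq_abs] at this
      exact (mul_le_mul_of_nonneg_left hxi (cellAmp_nonneg t)).trans hcx
    have hcos : ∀ u : ℝ, |u| ≤ 1 → 1 / 2 ≤ Real.cos u := by
      intro u hu
      rw [← Real.cos_abs, ← Real.cos_pi_div_three]
      exact Real.cos_le_cos_of_nonneg_of_le_pi (abs_nonneg _) (by linarith [Real.pi_pos]) (hu.trans hpi3)
    have hc0 : 1 / 2 ≤ Real.cos (driftShift t x 0) := by
      rw [driftShift_apply_zero]; exact hcos _ (hbox 0)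
    have hc2 : 1 / 2 ≤ Real.cos (driftShift t x 2) := by
      rw [driftShift_apply_two]; exact hcos _ (hbox 2)
    -- lower bound on the first component
    have hlow : C / Real.sqrt (-t) ≤ ‖driftProfile t x‖ := by
      have h0 : driftProfile t x 0 =
          cellAmp t * (Real.cos (driftShift t x 2) * Real.cos (driftShift t x 0)) := by
        simp only [driftProfile, PiLp.smul_apply, smul_eq_mul, cellField_apply_zero]
      have hprod : 1 / 4 ≤ Real.cos (driftShift t x 2) * Real.cos (driftShift t x 0) := by nlinarith
      calc C / Real.sqrt (-t) = cellAmp t * C := by rw [hamp, div_eq_inv_mul]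
        _ ≤ cellAmp t * (Real.cos (driftShift t x 2) * Real.cos (driftShift t x 0)) :=
            mul_le_mul_of_nonneg_left (by rw [hCdef]; exact hprod) (cellAmp_nonneg t)
        _ = |driftProfile t x 0| := by
            rw [h0, abs_of_nonneg (mul_nonneg (cellAmp_nonneg t) (by linarith))]
        _ = ‖driftProfile t x 0‖ := (Real.norm_eq_abs _).symm
        _ ≤ ‖driftProfile t x‖ := PiLp.norm_apply_le _ 0
    rw [← ofReal_norm, show ((N : ℝ≥0) : ℝ≥0∞) = ENNReal.ofReal (N : ℝ) by simp]
    rw [ENNReal.ofReal_lt_ofReal_iff (lt_of_lt_of_le (div_pos hC hspos) hlow)]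
    refine lt_of_lt_of_le ?_ hlow
    rw [lt_div_iff₀ hspos]
    have hst : Real.sqrt (-t) < C / K := by
      rw [Real.sqrt_lt' (div_pos hC hKpos)]
      linarith
    calc (N : ℝ) * Real.sqrt (-t) ≤ K * Real.sqrt (-t) :=
          mul_le_mul_of_nonneg_right (by rw [hK]; linarith) hspos.le
      _ < K * (C / K) := mul_lt_mul_of_pos_left hst hKpos
      _ = C := by field_simp

/-! ## The negative lemmas -/

/-- **An explicit Type-I profile with BOTH scale-sharp ClassRate bounds, every kinematic and genericity hypothesis of
the slice-wise sharpened residue S2 except the all-frames axisymmetry exclusion, and a backward singularity at the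
apex** — the drifting self-similar cellular profile. [folklore] -/
theorem exists_driftProfile_classRates_singular :
    ∃ (C C₁ C₂ : ℝ) (v : ℝ → EuclideanSpace ℝ (Fin 3) → EuclideanSpace ℝ (Fin 3)),
      HasTypeITimeDecay C v ∧
      ContinuousOn (Function.uncurry v) (Set.Iio (0 : ℝ) ×ˢ Set.univ) ∧
      (∀ t < 0, ∀ y, ‖fderiv ℝ (v t) y‖ ≤ C₁ / (-t)) ∧
      (∀ t < 0, ∀ y, ‖curl (v t) y‖ ≤ C₂ / (-t)) ∧
      (∀ t < 0, VectorCalculus.IsDivFree (v t)) ∧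
      (∀ s < 0, ∀ y, ⟪curl (v s) y, EuclideanSpace.single 2 1⟫_ℝ = 0) ∧
      (∀ s < 0, ∀ y, ⟪fderiv ℝ (v s) y (curl (v s) y), EuclideanSpace.single 2 1⟫_ℝ = 0) ∧
      (∀ s < 0, ∀ b : EuclideanSpace ℝ (Fin 3), b ≠ 0 → ∃ y, cross (curl (v s) y) b ≠ 0) ∧
      (∀ s < 0, ∃ y, fderiv ℝ (v s) y (EuclideanSpace.single 2 1) 0 ≠ 0 ∨
        fderiv ℝ (v s) y (EuclideanSpace.single 2 1) 1 ≠ 0) ∧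
      (∀ s < 0, ∀ a : EuclideanSpace ℝ (Fin 3), a ≠ 0 → ⟪a, EuclideanSpace.single 2 1⟫_ℝ = 0 →
        ∃ y, ⟪fderiv ℝ (v s) y a, EuclideanSpace.single 2 1⟫_ℝ ≠ 0) ∧
      (∀ s < 0, ∀ e : EuclideanSpace ℝ (Fin 3), e ≠ 0 →
        ∃ (y : EuclideanSpace ℝ (Fin 3)) (l : ℝ), v s (y + l • e) ≠ v s y) ∧
      (∃ lam : ℝ, 0 < lam ∧ ∃ s < 0, ∃ y, lam • v (lam ^ 2 * s) (lam • y) ≠ v s y) ∧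
      (∀ κ : ℝ, κ ≠ 0 → ∀ c : EuclideanSpace ℝ (Fin 3), ∃ s < 0, ∃ (a : ℝ) (y : EuclideanSpace ℝ (Fin 3)),
        v s (c + rotZ (κ * a) (y - c) + a • EuclideanSpace.single 2 (1 : ℝ)) ≠ rotZ (κ * a) (v s y)) ∧
      IsBackwardSingularPoint v 0 :=
  ⟨4, 8, 4, driftProfile, hasTypeITimeDecay_driftProfile, continuousOn_driftProfile,
    fun t ht y => norm_fderiv_driftProfile_le ht y, fun t ht y => norm_curl_driftProfile_le ht y,
    fun t _ => isDivFree_driftProfile t, fun s _ y => poloidal_driftProfile s y, fun s _ y => frozen_driftProfile s y,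
    fun s hs b hb => vorticityDirection_nonconstant_driftProfile hs b hb,
    fun s hs => (not_vertRigid_driftProfile hs).imp fun _ h => Or.inl h,
    fun s hs a ha ha2 => flat_in_no_horizontal_direction_driftProfile hs a ha ha2,
    fun s hs e he => not_translationInvariant_driftProfile hs e he,
    ⟨2, two_pos, -1, by norm_num, 0, not_scaleInvariant_driftProfile⟩,
    fun κ _ c => ⟨-1, by norm_num, Real.pi / 2, not_screwInvariant_driftProfile (κ * (Real.pi / 2)) c⟩,
    isBackwardSingularPoint_driftProfile⟩

/-- **The slice-wise sharpened residue S2 of K2 with the Oseen-mild identity REPLACED by its banked scale-sharp rates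
is FALSE.** The statement below is the registered signature of `stub_sliceSharpNoScrewNonflatLiouville` (skeleton
`Cruxes/PoloidalWindowRigidity/Lines/slicesharp.lean`, rev 6/7) with its third hypothesis (the Oseen-mild identity
(M)) replaced by the two conclusions of `…ClassRate` (`‖Dv(t)(y)‖ ≤ C₁/(−t)`, `‖curl v(t)(y)‖ ≤ C₂/(−t)`) and its
eleventh hypothesis (no axisymmetry in any frame) deleted; the drifting self-similar cellular profile refutes it. So any
proof of S2 (hence of S2′) must use (M) beyond slice regularity and beyond the parabolic rates. [folklore] -/
theorem sliceSharpResidue_false_with_classRates_without_mild :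
    ¬ (∀ (C C₁ C₂ : ℝ) (v : ℝ → EuclideanSpace ℝ (Fin 3) → EuclideanSpace ℝ (Fin 3)),
      Literature.Analysis.FluidPDE.HasTypeITimeDecay C v →
      ContinuousOn (Function.uncurry v) (Set.Iio (0 : ℝ) ×ˢ Set.univ) →
      (∀ t < 0, ∀ y, ‖fderiv ℝ (v t) y‖ ≤ C₁ / (-t)) →
      (∀ t < 0, ∀ y, ‖Literature.Analysis.FluidPDE.curl (v t) y‖ ≤ C₂ / (-t)) →
      (∀ t < 0, Literature.Analysis.FluidPDE.VectorCalculus.IsDivFree (v t)) →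
      (∀ s < 0, ∀ y, ⟪Literature.Analysis.FluidPDE.curl (v s) y, EuclideanSpace.single 2 1⟫_ℝ = 0) →
      (∀ s < 0, ∀ y, ⟪fderiv ℝ (v s) y (Literature.Analysis.FluidPDE.curl (v s) y), EuclideanSpace.single 2 1⟫_ℝ = 0) →
      (∀ s < 0, ∀ b : EuclideanSpace ℝ (Fin 3), b ≠ 0 → ∃ y,
        Literature.Analysis.FluidPDE.cross (Literature.Analysis.FluidPDE.curl (v s) y) b ≠ 0) →
      (∀ s < 0, ∃ y, fderiv ℝ (v s) y (EuclideanSpace.single 2 1) 0 ≠ 0 ∨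
        fderiv ℝ (v s) y (EuclideanSpace.single 2 1) 1 ≠ 0) →
      (∀ s < 0, ∀ a : EuclideanSpace ℝ (Fin 3), a ≠ 0 → ⟪a, EuclideanSpace.single 2 1⟫_ℝ = 0 →
        ∃ y, ⟪fderiv ℝ (v s) y a, EuclideanSpace.single 2 1⟫_ℝ ≠ 0) →
      (∀ s < 0, ∀ e : EuclideanSpace ℝ (Fin 3), e ≠ 0 → ∃ (y : EuclideanSpace ℝ (Fin 3)) (l : ℝ), v s (y + l • e) ≠ v s y) →
      (∃ lam : ℝ, 0 < lam ∧ ∃ s < 0, ∃ y, lam • v (lam ^ 2 * s) (lam • y) ≠ v s y) →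
      (∀ κ : ℝ, κ ≠ 0 → ∀ c : EuclideanSpace ℝ (Fin 3), ∃ s < 0, ∃ (a : ℝ) (y : EuclideanSpace ℝ (Fin 3)),
        v s (c + Literature.Analysis.FluidPDE.rotZ (κ * a) (y - c) + a • EuclideanSpace.single 2 (1 : ℝ)) ≠
          Literature.Analysis.FluidPDE.rotZ (κ * a) (v s y)) →
      ¬ Literature.Analysis.FluidPDE.IsBackwardSingularPoint v 0) := by
  intro h
  obtain ⟨C, C₁, C₂, v, hR, hC, h1, h2, hD, hP, hF, hrot, hvr, hflat, htr, hsc, hns, hS⟩ :=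
    exists_driftProfile_classRates_singular
  exact h C C₁ C₂ v hR hC h1 h2 hD hP hF hrot hvr hflat htr hsc hns hS

end Summit.NavierStokesRegularity.NavierStokesRegularity.Theorems.PoloidalWindowRigidity.Negative

end
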